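import Summits.HodgeConjecture.HodgeConjecture.Theorems.R90S6TwistedConstantTermValuePinned   -- TB2a FILE 2c part B (this seat): (V4-PIN) `lintegral_descEpsConj_indicator_doubleCoset_quotientMeasure_eq`, (V4-ONE); brings part A, ★ 2a∕2b, ★ 1c, ★ TJ1
import Summits.HodgeConjecture.HodgeConjecture.Theorems.R90S6TwistedNormFibreSum              -- ★ TB2d FILE B (p04): (B.2) `tsum_card_cells_normFibreParam_eq` (brings ★ TB3)
import HarnessLib

/-!
# R90 · S6 «Ch. 14.1–14.5 stable trace formula» — card TB2d FILE C, PINNED EDITION: THE ε-TWISTED ORBITAL INTEGRAL OF `𝟙_{K̃ϖ^λK̃}` AT AN ε-SPLIT `δ` AGAINST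
# THE CANONICAL QUOTIENT MEASURE `ν∕t` — SELECTION RULE AND NORM-FIBRE VALUE WITH THE CONSTANT `ν(K̃)∕t(T ∩ K̃)` (`Theorems/R90S6TwistedHyperbolicHeckeFLValuePinned.lean`)

Cell `hodgecm-mathlib`, crux H413 (`stmt-HodgeConjecture-24833`), route of record `HCCMUnconditional`; programme R90-TF (brief `director/R90-BRIEF.v2.md`), section S6
(base `R90-C14`), seat R90-C14-p06 (g2); dealer R90-C14-plan (g3) RULINGS #1 (R10) 03:36:32Z («p06 takes the pinned corollary `R90S6TwistedHyperbolicHeckeFLValuePinned`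
= ★ C p865088's three wrappers re-run with (V4-PIN)∕(V4-ONE)»).  ★ TB2d FILE C `R90S6TwistedHyperbolicHeckeFLValue` (R90-C14-p04 (g2), p865088) composed ★ TB2a (V4)
(`∃ c`, invariant Radon `μGT μGA μAT`, Haar `κ μ_N`, the mass `μAT(U₀)` unpinned) with ★ (B.2); this file is the SAME three wrappers over ★ TB2a FILE 2c part B's (V4-PIN)
— the canonical quotient `ν∕t` of Haar measures `ν` on `GL₃(K)` and `t` on `T = G̃_{δε}`, the constant EVALUATED to `ν(K̃) ∕ t(T ∩ K̃)` (and `1` at Rogawski's §4.3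
normalisation) — so the assembler's `hTO = J · S` binder (★ TB2d FILE A (A.2)) carries NO unpinned measure letter.  Lane `--kind proof --supports
stmt-HodgeConjecture-24833 --as helper`; THEOREMS ONLY (no definition ∕ instance ∕ notation ∕ named fact ∕ `sorry`); junction bytes of ★ A∕B∕C∕2a∕2b∕2c untouched.

## THE PRINT
[Rogawski1990, §4.10 (4.10.1)–(4.10.2), Prop. 4.10.1 (a) p. 58, Prop. 4.10.2 proof pp. 58–59; §4.3 (4.3.1) p. 43 (`vol K̃ = vol(T ∩ K̃) = 1`)]: at an ε-split
`δ = diag(d)` the ε-twisted orbital integral of `𝟙_{K̃ϖ^λK̃}` against the compatible measure `dg∕dt` is `J(δ) · Σ'_{(n,m)} #{γ ∈ K̃ϖ^λK̃∕K̃ : e(γ) = e(δ) + (n,2m,n)}`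
(★ (V4-ONE)), and the `ℤ²`-sum is `0` unless `Σλ ≡ Σe(δ) (mod 2)` (SELECTION RULE), else the norm-fibre count `N_k(λ) = Σ_{μ ∈ e(cells), μ₀−μ₂ = k} #{γ : e γ = μ}`,
`k = e(δ)₀ − e(δ)₂` (★ (B.2)), which ★ (B.4) reads as the base-change partner's Satake coefficient on the norm line.

## WHAT IS PROVED (namespace `Summit.HodgeConjecture.HodgeConjecture.R90.S6`; frame = ★ (V4-PIN)'s VERBATIM)
* (C.1-PIN) `lintegral_descEpsConj_indicator_zpowDiagGL_quotientMeasure_eq_mul_ite_sum_normFibre`: for every `λ`,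
  `∫⁻ 𝟙_{K̃ϖ^λK̃}(y δ ε(y)⁻¹) d(ν∕t) = (ν(K̃)∕t(T ∩ K̃)) · J(δ) · (if 2 ∣ Σλ − Σe(δ) then N_k(λ) else 0)`.
* (C.2-PIN) `lintegral_descEpsConj_indicator_zpowDiagGL_quotientMeasure_eq_zero_of_not_even`: the SELECTION RULE (`Σλ ≢ Σe(δ)` ⇒ the integral is `0`).
* (C.3-PIN) `lintegral_descEpsConj_indicator_zpowDiagGL_quotientMeasure_eq_mul_natCast_sum_normFibre`: in the parity case the value is
  `(ν(K̃)∕t(T ∩ K̃)) · J(δ) · (N_k(λ) : ℝ≥0∞)` with `N_k(λ) ∈ ℕ` cast ONCE (★ (B.4) reads `(N_k(λ) : ℂ)` by name).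
* (C.3-ONE) `lintegral_descEpsConj_indicator_zpowDiagGL_quotientMeasure_eq_mul_natCast_sum_normFibre_of_measure_eq_one`: at `ν(K̃) = 1`, `t(T ∩ K̃) = 1` the value is
  `J(δ) · (N_k(λ) : ℝ≥0∞)` — the `hTO = J · S` binder of ★ FILE A (A.2) with `S = N_k(λ)` and no measure constant.

HONEST LABEL: `α`, `t′` (Haar on `A`, transport of `t`) remain auxiliary hypotheses as in ★ 2c (★ CanonicalOne §2's convention); the `ℝ≥0∞ → ℂ` reading in
★ `Ch4Sec10.epsOrbitalIntegral` (Bochner) currency and the carrier junction `K = L_w` with ★ B2a are the assembling seat's.  Count-neutral; discharges no named input.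
HC_CM is proved only modulo the 7 printed citations (2 remaining named inputs: hLiu418 = `stmt-HodgeConjecture-24832`, h413 = `stmt-HodgeConjecture-24833`) until
rung 0 closes; REL ≠ ★ ≠ BUILT.

## References
* [Rogawski1990] J. D. Rogawski, *Automorphic Representations of Unitary Groups in Three Variables*, Ann. of Math. Stud. 123 (1990), §4.3 (4.3.1) p. 43,
  §4.10 (4.10.1)–(4.10.2), Prop. 4.10.1 (a), Prop. 4.10.2 pp. 57–59.
* [Kottwitz1986BaseChangeUnits] R. Kottwitz, *Base change for unit elements of Hecke algebras*, Compositio Math. 60 (1986), §1 pp. 239–240, §3.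
* [CartierCorvallis1979] P. Cartier, *Representations of 𝔭-adic groups: a survey*, PSPM 33.1 (1979), §IV (4.2) p. 146.
* [DeitmarEchterhoff2014] A. Deitmar, S. Echterhoff, *Principles of Harmonic Analysis*, 2nd ed. (2014), Thm. 1.5.3.
-/

set_option autoImplicit false
-- the mandated namespace repeats the single-problem summit's segment (`HodgeConjecture.HodgeConjecture`)
set_option linter.dupNamespace false

noncomputable section

open MeasureTheory Measure Set Function Filter Topology
open scoped ENNReal NNReal Pointwise MatrixGroups
open ValuativeRel MulAction Finset
open Literature.NumberTheory.Automorphic Literature.MeasureTheory.Group Literature.NumberTheory.Rogawski1990.Ch4Sec10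
open Literature.NumberTheory.GaloisRepresentations Literature.NumberTheory.GaloisRepresentations.IsNonarchimedeanLocalField
open Literature.NumberTheory.Automorphic.heckeAlgebra

namespace Summit.HodgeConjecture.HodgeConjecture.R90.S6

section Value

-- the frame of ★ TB2a FILE 2c part B (V4-PIN), VERBATIM
variable {K : Type*} [Field K] [ValuativeRel K] [TopologicalSpace K] [IsNonarchimedeanLocalField K] [MeasurableSpace K] [BorelSpace K]
  [IsDiscreteValuationRing 𝒪[K]] {ϖ : K} (hϖ : IsUniformizingElement ϖ)
  [MeasurableSpace (GL (Fin 3) K)] [BorelSpace (GL (Fin 3) K)]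
  (σ : K →+* K) (hσ : ∀ x, σ (σ x) = x) (hσc : Continuous σ)
  (ε : GL (Fin 3) K →* GL (Fin 3) K) (hε : Continuous ε) (hεΘ : ∀ g, ε g = UnitaryGroup.qsInvolution σ g)
  (hεK : ∀ k ∈ glInt 3 K, ε k ∈ glInt 3 K)
  (δ : GL (Fin 3) K) (d : Fin 3 → K) (hδ : (δ : Matrix (Fin 3) (Fin 3) K) = Matrix.diagonal d)

include hϖ hσ hσc hε hεΘ hεK hδ in
/-- **(C.1-PIN) THE ε-TWISTED ORBITAL INTEGRAL OF `𝟙_{K̃ϖ^λK̃}` AT AN ε-SPLIT `δ` AGAINST `ν∕t`: SELECTION RULE AND NORM-FIBRE COUNT.**  In ★ (V4-PIN)'s frame VERBATIM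
(`ν` Haar on `GL₃(K)` right invariant, `t` Haar on `T = G̃_{δε}` inversion invariant, `α`, `t′` auxiliary), for every `λ : Fin 3 → ℤ`, with `e = iwasawaExp hϖ`, `O_λ` the
`K̃`-cells of `K̃ϖ^λK̃` and `J(δ)` = ★ TJ1's constant:
`∫⁻ 𝟙_{K̃ϖ^λK̃}(y δ ε(y)⁻¹) d(ν∕t)(y) = (ν(K̃) ∕ t(T ∩ K̃)) · J(δ) · (if 2 ∣ Σλ − Σ e(δ) then Σ_{μ ∈ e(O_λ), μ₀ − μ₂ = e(δ)₀ − e(δ)₂} #{γ ∈ O_λ : e γ = μ} else 0)` —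
★ (V4-PIN) at `g = ϖ^λ` ∘ ★ (B.2) `tsum_card_cells_normFibreParam_eq`.
[cite: Rogawski1990, §4.10 (4.10.1) p. 57, Prop. 4.10.2 proof pp. 58–59; §4.3 (4.3.1) p. 43] [cite: Kottwitz1986BaseChangeUnits, §1 pp. 239–240] [cite: CartierCorvallis1979, §IV (4.2) p. 146] -/
theorem lintegral_descEpsConj_indicator_zpowDiagGL_quotientMeasure_eq_mul_ite_sum_normFibre (hσ1 : ∃ x, σ x ≠ x)
    [T2Space (GL (Fin 3) K)] [SecondCountableTopology (GL (Fin 3) K)] [LocallyCompactSpace (GL (Fin 3) K)]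
    [IsHeckeTriple (⊤ : Submonoid (GL (Fin 3) K)) (glInt 3 K) (glInt 3 K)]
    (ha : d 2 / d 1 * σ (d 1 / d 0) - 1 ≠ 0) (hb : 1 - d 2 / d 0 * σ (d 2 / d 0) ≠ 0)
    {A : Subgroup (GL (Fin 3) K)} (hAid : A = standardLeviGL K (_root_.id : Fin 3 → Fin 3)) (hA : IsClosed (A : Set (GL (Fin 3) K)))
    (hT : IsClosed (epsCentralizer ε δ : Set (GL (Fin 3) K))) (hTA : epsCentralizer ε δ ≤ A)
    [MeasurableSpace (GL (Fin 3) K ⧸ epsCentralizer ε δ)] [BorelSpace (GL (Fin 3) K ⧸ epsCentralizer ε δ)]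
    [MeasurableSpace (GL (Fin 3) K ⧸ A)] [BorelSpace (GL (Fin 3) K ⧸ A)]
    [MeasurableSpace (↥A ⧸ (epsCentralizer ε δ).subgroupOf A)] [BorelSpace (↥A ⧸ (epsCentralizer ε δ).subgroupOf A)]
    (ν : Measure (GL (Fin 3) K)) [IsHaarMeasure ν] [ν.IsMulRightInvariant]
    (α : Measure ↥A) [IsHaarMeasure α] [α.IsMulRightInvariant] [α.IsInvInvariant]
    (t : Measure ↥(epsCentralizer ε δ)) [IsHaarMeasure t] [t.IsInvInvariant]
    (t' : Measure ↥((epsCentralizer ε δ).subgroupOf A)) [IsHaarMeasure t'] [t'.IsInvInvariant]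
    (ht' : t' = Measure.map (Subgroup.subgroupOfEquivOfLe hTA).symm t) (lam : Fin 3 → ℤ) :
    ∫⁻ y, descEpsConj ε δ (epsCentralizer ε δ)
        (((glInt 3 K : Set (GL (Fin 3) K)) * {zpowDiagGL hϖ.ne_zero lam} * (glInt 3 K : Set (GL (Fin 3) K))).indicator
          (1 : GL (Fin 3) K → ℝ≥0∞)) y ∂(quotientMeasure (epsCentralizer ε δ) t hT ν) =
      ν (glInt 3 K : Set (GL (Fin 3) K)) / t (Subtype.val ⁻¹' (glInt 3 K : Set (GL (Fin 3) K))) *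
        ((((normAbs K (d 2 / d 1 * σ (d 1 / d 0) - 1))⁻¹ * (NNReal.sqrt (normAbs K (1 - d 2 / d 0 * σ (d 2 / d 0))))⁻¹ : ℝ≥0)) : ℝ≥0∞) *
        (if 2 ∣ ∑ i, lam i - ∑ i, iwasawaExp hϖ δ i then
          ∑ μ ∈ ((finite_orbit_quotient (glInt 3 K) (zpowDiagGL hϖ.ne_zero lam)).toFinset.image fun γ => iwasawaExp hϖ γ.out) with
              μ 0 - μ 2 = iwasawaExp hϖ δ 0 - iwasawaExp hϖ δ 2,
            (((finite_orbit_quotient (glInt 3 K) (zpowDiagGL hϖ.ne_zero lam)).toFinset.filter fun γ => iwasawaExp hϖ γ.out = μ).card : ℝ≥0∞)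
        else 0) := by
  rw [lintegral_descEpsConj_indicator_doubleCoset_quotientMeasure_eq hϖ σ hσ hσc ε hε hεΘ hεK δ d hδ hσ1 ha hb hAid hA hT hTA ν α t t' ht'
      (zpowDiagGL hϖ.ne_zero lam), tsum_card_cells_normFibreParam_eq hϖ lam (iwasawaExp hϖ δ)]

include hϖ hσ hσc hε hεΘ hεK hδ in
/-- **(C.2-PIN) THE SELECTION RULE FOR THE TWISTED ORBITAL INTEGRAL AGAINST `ν∕t`**: if `Σλ ≢ Σ e(δ) (mod 2)` then `∫⁻ 𝟙_{K̃ϖ^λK̃}(y δ ε(y)⁻¹) d(ν∕t)(y) = 0` — the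
shell `K̃ϖ^λK̃` misses the whole ε-orbit of `δ` (the wrong-parity ε-class of (4.10.1) carries nothing).
[cite: Rogawski1990, §4.10 (4.10.1) p. 57; §3.11 p. 35] [cite: Kottwitz1986BaseChangeUnits, §3] -/
theorem lintegral_descEpsConj_indicator_zpowDiagGL_quotientMeasure_eq_zero_of_not_even (hσ1 : ∃ x, σ x ≠ x)
    [T2Space (GL (Fin 3) K)] [SecondCountableTopology (GL (Fin 3) K)] [LocallyCompactSpace (GL (Fin 3) K)]
    [IsHeckeTriple (⊤ : Submonoid (GL (Fin 3) K)) (glInt 3 K) (glInt 3 K)]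
    (ha : d 2 / d 1 * σ (d 1 / d 0) - 1 ≠ 0) (hb : 1 - d 2 / d 0 * σ (d 2 / d 0) ≠ 0)
    {A : Subgroup (GL (Fin 3) K)} (hAid : A = standardLeviGL K (_root_.id : Fin 3 → Fin 3)) (hA : IsClosed (A : Set (GL (Fin 3) K)))
    (hT : IsClosed (epsCentralizer ε δ : Set (GL (Fin 3) K))) (hTA : epsCentralizer ε δ ≤ A)
    [MeasurableSpace (GL (Fin 3) K ⧸ epsCentralizer ε δ)] [BorelSpace (GL (Fin 3) K ⧸ epsCentralizer ε δ)]
    [MeasurableSpace (GL (Fin 3) K ⧸ A)] [BorelSpace (GL (Fin 3) K ⧸ A)]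
    [MeasurableSpace (↥A ⧸ (epsCentralizer ε δ).subgroupOf A)] [BorelSpace (↥A ⧸ (epsCentralizer ε δ).subgroupOf A)]
    (ν : Measure (GL (Fin 3) K)) [IsHaarMeasure ν] [ν.IsMulRightInvariant]
    (α : Measure ↥A) [IsHaarMeasure α] [α.IsMulRightInvariant] [α.IsInvInvariant]
    (t : Measure ↥(epsCentralizer ε δ)) [IsHaarMeasure t] [t.IsInvInvariant]
    (t' : Measure ↥((epsCentralizer ε δ).subgroupOf A)) [IsHaarMeasure t'] [t'.IsInvInvariant]
    (ht' : t' = Measure.map (Subgroup.subgroupOfEquivOfLe hTA).symm t)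
    {lam : Fin 3 → ℤ} (hpar : ¬ 2 ∣ ∑ i, lam i - ∑ i, iwasawaExp hϖ δ i) :
    ∫⁻ y, descEpsConj ε δ (epsCentralizer ε δ)
        (((glInt 3 K : Set (GL (Fin 3) K)) * {zpowDiagGL hϖ.ne_zero lam} * (glInt 3 K : Set (GL (Fin 3) K))).indicator
          (1 : GL (Fin 3) K → ℝ≥0∞)) y ∂(quotientMeasure (epsCentralizer ε δ) t hT ν) = 0 := by
  rw [lintegral_descEpsConj_indicator_zpowDiagGL_quotientMeasure_eq_mul_ite_sum_normFibre hϖ σ hσ hσc ε hε hεΘ hεK δ d hδ hσ1 ha hb hAid hA hT hTA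
      ν α t t' ht' lam, if_neg hpar, mul_zero]

include hϖ hσ hσc hε hεΘ hεK hδ in
/-- **(C.3-PIN) THE VALUE IN THE PARITY CASE AGAINST `ν∕t`, COUNT CAST ONCE**: for every `λ` with `Σλ ≡ Σ e(δ) (mod 2)`,
`∫⁻ 𝟙_{K̃ϖ^λK̃}(y δ ε(y)⁻¹) d(ν∕t)(y) = (ν(K̃) ∕ t(T ∩ K̃)) · J(δ) · (N_k(λ) : ℝ≥0∞)`, `N_k(λ) = Σ_{μ ∈ e(O_λ), μ₀ − μ₂ = k} #{γ ∈ O_λ : e γ = μ} ∈ ℕ`,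
`k = e(δ)₀ − e(δ)₂` — ★ (B.4) reads `(N_k(λ) : ℂ) = u^{2k} · (𝒮_w(b c_λ))_{ℓ_k}` by name. [cite: Rogawski1990, §4.10 Prop. 4.10.1 (a), Prop. 4.10.2 pp. 58–59; §4.3 (4.3.1) p. 43]
[cite: CartierCorvallis1979, §IV (4.2) p. 146] -/
theorem lintegral_descEpsConj_indicator_zpowDiagGL_quotientMeasure_eq_mul_natCast_sum_normFibre (hσ1 : ∃ x, σ x ≠ x)
    [T2Space (GL (Fin 3) K)] [SecondCountableTopology (GL (Fin 3) K)] [LocallyCompactSpace (GL (Fin 3) K)]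
    [IsHeckeTriple (⊤ : Submonoid (GL (Fin 3) K)) (glInt 3 K) (glInt 3 K)]
    (ha : d 2 / d 1 * σ (d 1 / d 0) - 1 ≠ 0) (hb : 1 - d 2 / d 0 * σ (d 2 / d 0) ≠ 0)
    {A : Subgroup (GL (Fin 3) K)} (hAid : A = standardLeviGL K (_root_.id : Fin 3 → Fin 3)) (hA : IsClosed (A : Set (GL (Fin 3) K)))
    (hT : IsClosed (epsCentralizer ε δ : Set (GL (Fin 3) K))) (hTA : epsCentralizer ε δ ≤ A)
    [MeasurableSpace (GL (Fin 3) K ⧸ epsCentralizer ε δ)] [BorelSpace (GL (Fin 3) K ⧸ epsCentralizer ε δ)]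
    [MeasurableSpace (GL (Fin 3) K ⧸ A)] [BorelSpace (GL (Fin 3) K ⧸ A)]
    [MeasurableSpace (↥A ⧸ (epsCentralizer ε δ).subgroupOf A)] [BorelSpace (↥A ⧸ (epsCentralizer ε δ).subgroupOf A)]
    (ν : Measure (GL (Fin 3) K)) [IsHaarMeasure ν] [ν.IsMulRightInvariant]
    (α : Measure ↥A) [IsHaarMeasure α] [α.IsMulRightInvariant] [α.IsInvInvariant]
    (t : Measure ↥(epsCentralizer ε δ)) [IsHaarMeasure t] [t.IsInvInvariant]
    (t' : Measure ↥((epsCentralizer ε δ).subgroupOf A)) [IsHaarMeasure t'] [t'.IsInvInvariant]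
    (ht' : t' = Measure.map (Subgroup.subgroupOfEquivOfLe hTA).symm t)
    {lam : Fin 3 → ℤ} (hpar : 2 ∣ ∑ i, lam i - ∑ i, iwasawaExp hϖ δ i) :
    ∫⁻ y, descEpsConj ε δ (epsCentralizer ε δ)
        (((glInt 3 K : Set (GL (Fin 3) K)) * {zpowDiagGL hϖ.ne_zero lam} * (glInt 3 K : Set (GL (Fin 3) K))).indicator
          (1 : GL (Fin 3) K → ℝ≥0∞)) y ∂(quotientMeasure (epsCentralizer ε δ) t hT ν) =
      ν (glInt 3 K : Set (GL (Fin 3) K)) / t (Subtype.val ⁻¹' (glInt 3 K : Set (GL (Fin 3) K))) *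
        ((((normAbs K (d 2 / d 1 * σ (d 1 / d 0) - 1))⁻¹ * (NNReal.sqrt (normAbs K (1 - d 2 / d 0 * σ (d 2 / d 0))))⁻¹ : ℝ≥0)) : ℝ≥0∞) *
        ((∑ μ ∈ ((finite_orbit_quotient (glInt 3 K) (zpowDiagGL hϖ.ne_zero lam)).toFinset.image fun γ => iwasawaExp hϖ γ.out) with
              μ 0 - μ 2 = iwasawaExp hϖ δ 0 - iwasawaExp hϖ δ 2,
            ((finite_orbit_quotient (glInt 3 K) (zpowDiagGL hϖ.ne_zero lam)).toFinset.filter fun γ => iwasawaExp hϖ γ.out = μ).card : ℕ) : ℝ≥0∞) := by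
  rw [lintegral_descEpsConj_indicator_zpowDiagGL_quotientMeasure_eq_mul_ite_sum_normFibre hϖ σ hσ hσc ε hε hεΘ hεK δ d hδ hσ1 ha hb hAid hA hT hTA
      ν α t t' ht' lam, if_pos hpar, Nat.cast_sum]

include hϖ hσ hσc hε hεΘ hεK hδ in
/-- **(C.3-ONE) THE VALUE AT ROGAWSKI'S NORMALISATION** (`vol K̃ = 1`, `vol (T ∩ K̃) = 1`, §4.3): under `ν(K̃) = 1`, `t(T ∩ K̃) = 1`, for every `λ` with
`Σλ ≡ Σ e(δ) (mod 2)`, `∫⁻ 𝟙_{K̃ϖ^λK̃}(y δ ε(y)⁻¹) d(ν∕t)(y) = J(δ) · (N_k(λ) : ℝ≥0∞)` — the `hTO = J · S` binder of ★ TB2d FILE A (A.2) with `S = N_k(λ)` and NO measure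
constant. [cite: Rogawski1990, §4.3 (4.3.1) p. 43; §4.10 Prop. 4.10.2 proof pp. 58–59] [cite: CartierCorvallis1979, §IV (4.2) p. 146] -/
theorem lintegral_descEpsConj_indicator_zpowDiagGL_quotientMeasure_eq_mul_natCast_sum_normFibre_of_measure_eq_one (hσ1 : ∃ x, σ x ≠ x)
    [T2Space (GL (Fin 3) K)] [SecondCountableTopology (GL (Fin 3) K)] [LocallyCompactSpace (GL (Fin 3) K)]
    [IsHeckeTriple (⊤ : Submonoid (GL (Fin 3) K)) (glInt 3 K) (glInt 3 K)]
    (ha : d 2 / d 1 * σ (d 1 / d 0) - 1 ≠ 0) (hb : 1 - d 2 / d 0 * σ (d 2 / d 0) ≠ 0)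
    {A : Subgroup (GL (Fin 3) K)} (hAid : A = standardLeviGL K (_root_.id : Fin 3 → Fin 3)) (hA : IsClosed (A : Set (GL (Fin 3) K)))
    (hT : IsClosed (epsCentralizer ε δ : Set (GL (Fin 3) K))) (hTA : epsCentralizer ε δ ≤ A)
    [MeasurableSpace (GL (Fin 3) K ⧸ epsCentralizer ε δ)] [BorelSpace (GL (Fin 3) K ⧸ epsCentralizer ε δ)]
    [MeasurableSpace (GL (Fin 3) K ⧸ A)] [BorelSpace (GL (Fin 3) K ⧸ A)]
    [MeasurableSpace (↥A ⧸ (epsCentralizer ε δ).subgroupOf A)] [BorelSpace (↥A ⧸ (epsCentralizer ε δ).subgroupOf A)]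
    (ν : Measure (GL (Fin 3) K)) [IsHaarMeasure ν] [ν.IsMulRightInvariant]
    (α : Measure ↥A) [IsHaarMeasure α] [α.IsMulRightInvariant] [α.IsInvInvariant]
    (t : Measure ↥(epsCentralizer ε δ)) [IsHaarMeasure t] [t.IsInvInvariant]
    (t' : Measure ↥((epsCentralizer ε δ).subgroupOf A)) [IsHaarMeasure t'] [t'.IsInvInvariant]
    (ht' : t' = Measure.map (Subgroup.subgroupOfEquivOfLe hTA).symm t)
    (hν : ν (glInt 3 K : Set (GL (Fin 3) K)) = 1) (ht : t (Subtype.val ⁻¹' (glInt 3 K : Set (GL (Fin 3) K))) = 1)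
    {lam : Fin 3 → ℤ} (hpar : 2 ∣ ∑ i, lam i - ∑ i, iwasawaExp hϖ δ i) :
    ∫⁻ y, descEpsConj ε δ (epsCentralizer ε δ)
        (((glInt 3 K : Set (GL (Fin 3) K)) * {zpowDiagGL hϖ.ne_zero lam} * (glInt 3 K : Set (GL (Fin 3) K))).indicator
          (1 : GL (Fin 3) K → ℝ≥0∞)) y ∂(quotientMeasure (epsCentralizer ε δ) t hT ν) =
      ((((normAbs K (d 2 / d 1 * σ (d 1 / d 0) - 1))⁻¹ * (NNReal.sqrt (normAbs K (1 - d 2 / d 0 * σ (d 2 / d 0))))⁻¹ : ℝ≥0)) : ℝ≥0∞) *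
        ((∑ μ ∈ ((finite_orbit_quotient (glInt 3 K) (zpowDiagGL hϖ.ne_zero lam)).toFinset.image fun γ => iwasawaExp hϖ γ.out) with
              μ 0 - μ 2 = iwasawaExp hϖ δ 0 - iwasawaExp hϖ δ 2,
            ((finite_orbit_quotient (glInt 3 K) (zpowDiagGL hϖ.ne_zero lam)).toFinset.filter fun γ => iwasawaExp hϖ γ.out = μ).card : ℕ) : ℝ≥0∞) := by
  rw [lintegral_descEpsConj_indicator_zpowDiagGL_quotientMeasure_eq_mul_natCast_sum_normFibre hϖ σ hσ hσc ε hε hεΘ hεK δ d hδ hσ1 ha hb hAid hA hT hTA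
      ν α t t' ht' hpar, hν, ht, ENNReal.div_self one_ne_zero ENNReal.one_ne_top, one_mul]

end Value

end Summit.HodgeConjecture.HodgeConjecture.R90.S6

end
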